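import Literature.MathematicalPhysics.QuantumLattice.OverlapOperatorZd
import Literature.MathematicalPhysics.QuantumLattice.AbelianFieldTensorZd
import HarnessLib

/-!
# The anomaly density on the torus and the periodic extension of torus gauge fields to `ℤ⁴`

The comparison vocabulary of Igarashi–Okuyama–Suzuki, Nucl. Phys. B 644 (2002) 383,
arXiv:hep-lat/0206003, §2: "when we compare objects on the finite lattice `Γ` and on the infinite
lattice, we always take repeated copies of a configuration of the gauge field on `Γ` as the
gauge-field configuration on the infinite lattice" (text before (2.7)).

* `anomalyDensity ρ U m₀ x` — the axial anomaly density (2.1) on the periodic lattice (colour–spin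
  trace of the diagonal block of `Γ₅(1 − ½D₀)`, `D₀ = overlapDirac ρ U m₀ 0`), with
  `sum_anomalyDensity`: `Σ_Γ 𝒜 = Re Tr Γ₅(1 − ½D₀)`, the left side of the index theorem (2.3);
* `toTorusSite`, `liftSite`, `pullbackZd` — reduction mod `L`, the canonical lift, and the
  **periodic extension** `Ũ(y,μ) = U(y mod L, μ)` of a torus gauge field to `LGConfig d G`, its
  `Lℤ^d`-periodicity, and the identification of its plaquettes / abelian field tensor / `εFF`
  density with the torus ones (`plaquetteHolonomyZd_pullbackZd`, `abelianFieldTensorZd_pullbackZd`,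
  `epsFFZd_pullbackZd`).

Definitions with bodies and proved lemmas only; no named facts. The comparison of the overlap
kernels themselves (IOS (2.7), `‖D(x,x) − D^∞(x,x)‖ ≤ κ L^ν e^{−L/ϱ}`) is an infinite-lattice
theorem NOT in the tree; it enters `AbelianFluxSectorsIndexReduction.lean` as a hypothesis.

## References

* H. Igarashi, K. Okuyama, H. Suzuki, Nucl. Phys. B 644 (2002) 383–394, arXiv:hep-lat/0206003,
  §2 eqs. (2.1), (2.3) and the text before (2.7). [IgarashiOkuyamaSuzuki2002]
-/

noncomputable section

open Finset
open scoped InnerProductSpace ComplexConjugate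
open Literature.Probability.LatticeModels (Site)

namespace Literature.MathematicalPhysics.QuantumLattice

section TorusAnomaly

open Literature.Probability.LatticeModels (TorusSite)
open Literature.MathematicalPhysics.QuantumFieldTheory

variable {L N : ℕ} [NeZero L] {G : Type*} [Group G] (ρ : G →* Matrix (Fin N) (Fin N) ℂ)

/-- **The axial anomaly density on the periodic lattice** `Γ = (ℤ/Lℤ)⁴`:
`𝒜(x) = Σ_{a,α} Re [Γ₅(1 − ½D₀)]((x,a,α),(x,a,α))` for the overlap operator `D₀ = overlapDirac ρ U m₀ 0`
(IOS (2.1); the trace over colour and spin of the diagonal block at `x`). [cite: IgarashiOkuyamaSuzuki2002, §2 eq. (2.1)] -/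
def anomalyDensity (U : GaugeConfig 4 L G) (m₀ : ℝ) (x : TorusSite 4 L) : ℝ :=
  ∑ a : Fin N, ∑ α : Fin 4,
    (((spinorLift gammaFive * (1 - (2⁻¹ : ℂ) • overlapDirac ρ U m₀ 0) :
      Matrix (TorusSite 4 L × Fin N × Fin 4) (TorusSite 4 L × Fin N × Fin 4) ℂ) (x, a, α) (x, a, α))).re

/-- `Σ_{x∈Γ} 𝒜(x) = Re Tr Γ₅(1 − ½D₀)` (the left side of the index theorem (2.3)).
[cite: IgarashiOkuyamaSuzuki2002, §2 eq. (2.3)] -/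
theorem sum_anomalyDensity (U : GaugeConfig 4 L G) (m₀ : ℝ) :
    ∑ x : TorusSite 4 L, anomalyDensity ρ U m₀ x =
      ((spinorLift gammaFive * (1 - (2⁻¹ : ℂ) • overlapDirac ρ U m₀ 0)).trace).re := by
  rw [Matrix.trace, Complex.re_sum, Fintype.sum_prod_type]
  refine Finset.sum_congr rfl fun x _ => ?_
  rw [anomalyDensity, Fintype.sum_prod_type]
  rfl

end TorusAnomaly

section Pullback

open Literature.Probability.LatticeModels (TorusSite)
open Literature.MathematicalPhysics.QuantumFieldTheory

variable {d L : ℕ} {G : Type*}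

/-- Reduction of an infinite-lattice site modulo `L`. [folklore] -/
def toTorusSite (L : ℕ) (y : Site d) : TorusSite d L := fun i => ((y i : ℤ) : ZMod L)

/-- The canonical lift `{0,…,L−1}^d` of a torus site. [folklore] -/
def liftSite (x : TorusSite d L) : Site d := fun i => ((x i).val : ℤ)

/-- `lift` then `reduce` is the identity. [folklore] -/
theorem toTorusSite_liftSite [NeZero L] (x : TorusSite d L) : toTorusSite L (liftSite x) = x := by
  funext i
  simp [toTorusSite, liftSite]

/-- Reduction commutes with unit shifts. [folklore] -/
theorem toTorusSite_add_single (y : Site d) (μ : Fin d) (c : ℤ) :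
    toTorusSite L (y + Pi.single μ c) = toTorusSite L y + Pi.single μ (c : ZMod L) := by
  funext i
  by_cases h : i = μ
  · subst h; simp [toTorusSite]
  · simp [toTorusSite, h]

/-- Reduction forgets shifts by `L ℤ^d`. [folklore] -/
theorem toTorusSite_add_smul (y v : Site d) : toTorusSite L (y + (L : ℤ) • v) = toTorusSite L y := by
  funext i
  simp [toTorusSite]

/-- **Periodic extension** ("repeated copies") of a torus gauge field to the infinite lattice:
`Ũ(y, μ) = U(y mod L, μ)`. [cite: IgarashiOkuyamaSuzuki2002, §2 ("we always take repeated copies of a configuration of the gauge field on Γ as the gauge-field configuration on the infinite lattice")] -/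
def pullbackZd (U : GaugeConfig d L G) : LGConfig d G := fun e => U (toTorusSite L e.1, e.2)

/-- The periodic extension is `L`-periodic. [folklore] -/
theorem pullbackZd_add_smul (U : GaugeConfig d L G) (y v : Site d) (μ : Fin d) :
    pullbackZd U (y + (L : ℤ) • v, μ) = pullbackZd U (y, μ) := by
  show U (toTorusSite L (y + (L : ℤ) • v), μ) = U (toTorusSite L y, μ)
  rw [toTorusSite_add_smul]

/-- Shifting the periodic extension by a lattice vector `L v` gives it back. [folklore] -/
theorem pullbackZd_shift_smul (U : GaugeConfig d L G) (v : Site d) :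
    (fun e : ZdEdge d => pullbackZd U (e.1 + (L : ℤ) • v, e.2)) = pullbackZd U := by
  funext e
  exact pullbackZd_add_smul U e.1 v e.2

/-- The plaquettes of the periodic extension are the torus plaquettes. [folklore] -/
theorem plaquetteHolonomyZd_pullbackZd [Group G] (U : GaugeConfig d L G) (y : Site d) (μ ν : Fin d) :
    plaquetteHolonomyZd (pullbackZd U) y μ ν = plaquetteHolonomy U (toTorusSite L y) μ ν := by
  simp only [plaquetteHolonomyZd, plaquetteHolonomy, pullbackZd, toTorusSite_add_single, Int.cast_one,
    QuantumFieldTheory.Site.shift]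

/-- The field tensor of the periodic extension is the torus field tensor. [folklore] -/
theorem abelianFieldTensorZd_pullbackZd (U : GaugeConfig d L Circle) (y : Site d) (μ ν : Fin d) :
    abelianFieldTensorZd (pullbackZd U) y μ ν = abelianFieldTensor U (toTorusSite L y) μ ν := by
  rw [abelianFieldTensorZd, abelianFieldTensor, plaquetteHolonomyZd_pullbackZd]

/-- The `εFF` density of the periodic extension is the torus density. [folklore] -/
theorem epsFFZd_pullbackZd (U : GaugeConfig 4 L Circle) (y : Site 4) :
    epsFFZd (pullbackZd U) y = epsFF U (toTorusSite L y) := by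
  simp only [epsFFZd, epsFF, abelianFieldTensorZd_pullbackZd, toTorusSite_add_single, Int.cast_one,
    QuantumFieldTheory.Site.shift]

end Pullback

end Literature.MathematicalPhysics.QuantumLattice
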